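/- Copyright: the b2b-balaban cell (near-miss cell 7), T⁴-continuum fan-out, lineage t4-ne7b-p1 (row NE7b OWNER + CRUX
PROVER NE7b), gen 46: (α)-M5-4a «THE FIBRE ROOM» — the room in print's rounding for the fibre factor of the `resumM`
spec (ruling R-OWNER-46-1).  Released under the licence of the surrounding project. -/
import Summits.QuantumFields.BalabanUV.T4Continuum.Support.HistoryBankingCreditPlug

/-!
# M5-4a: THE FIBRE ROOM — `LIVE · MULT ≤ PRICE` by inflating the event-wise factor letters (re-open object (α) of row
NE7b, `SCOPE-alpha.md` §5 row M5; ruling R-OWNER-46-1 «M5-4 THE FIBRE READING», owner gen 46)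

Summits-side support leaf of the T⁴-continuum cell (rung (B)+1 on a FINITE torus only; NOT infinite volume, NOT the
mass gap, NOT the Clay statement; NOT a proof of the spine estimate NE7b — the cell's OWN estimate, NOT PRINTED, NOT
PROVED).  [folklore] real arithmetic over the gen-45 credit modules (`HistoryBankingDiscountCharge`: `dshare`, `mshare`,
`RoundingRoom`; `HistoryBankingCreditRead`: `FactorRead`, `evProd_le_exp_neg_credits_mul_exp_neg_discount`,
`evProd_toPGen_le_genT`; `HistoryBankingCreditPlug`: `liveFactor_pedMV_le`, `prod_liveFactor_pedMV_le`) and the owner's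
ledger (`HistoryGenealogyExtractionLedger.evProd`); no `[cite:]` tag, nothing printed asserted, no `Prop` fact of
Bałaban's minted, zero `sorry`.

WHY (the `resumM` spec, R-OWNER-46-1).  The END's numerator reading asks, per bad physical live family `k`,
`upM : A ≤ dead · FcM k · nup`, `resumM : Σ_{fibre k} dead ≤ RfM k` and `priceM : FcM k · RfM k ≤ PRICE k`.  With M2 brick B
(`B16HistoryWeightPlug.weight_le_live_mul_dead`: `weight ≤ LIVE · DEAD · rest`) the fibre sum is the FIBRE MASS of the
histories sharing one physical live family (sub-history multiplicity × curly normalisation × last-exponent envelope; a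
located VOLUME-type display (ρ) `FibreMass ≤ W K · MULT k`), so `RfM k := MULT k = ∏_{members} exp (fibre share)` and
`priceM` needs ROOM: `LIVE k · MULT k ≤ PRICE k`.  This file supplies that room from print's rounding read WITH THE FIBRE
SHARE BOOKED (`RoundingRoomF`, two clauses shaped like gen 45's `RoundingRoom` plus one displayed per-event share `φB` ∕
`φR`), by INFLATING the factor letters: `fB′ := fB · e^{φB}`, `fR′ := fR · e^{φR}` satisfy `FactorRead fB′ fR′ (sB − φB)
(sR − φR)` and `RoundingRoom … (sB − φB) (sR − φR)`, and `evProd fB′ fR′ P = evProd fB fR P · exp (fshareP φB φR P)`; hence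
every gen-45 inequality applies VERBATIM at the primed letters and yields the fibre factor on the left — no induction is
re-proved, no landed statement is touched.

WHAT.  §1 `inflB`∕`inflR` (inflated letters), `fshareP` (the node sum of the shares over a `PGen`: births `φB j d′`,
renewals `φR h`, joins nothing), **`evProd_infl`**, `fshareP_nonneg`, **`factorRead_infl`**.  §2 **`structure RoundingRoomF
C O L K R g sB sR φB φR`** (R-class HYPOTHESIS SHAPE: birth `pcredit + dshare + mshare s + φB j d′ ≤ sB j d′`, renewal
`pcredit + dshare + φR h ≤ sR h`), **`RoundingRoomF.toRoundingRoom`** (at the reduced sharps), `RoundingRoomF.roundingRoom`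
(forgetting nonnegative shares), `roundingRoomF_zero_iff` (`φ = 0` ⇔ gen 45's `RoundingRoom`).  §3 THE ROOM on genealogies:
**`evProd_mul_exp_fshareP_le`** (`evProd fB fR P · e^{fshareP P} ≤ e^{−credits G} · e^{−Ξ G}` for `relabel sh G = P.toGen`),
`evProd_toPGen_mul_exp_fshareP_le_genT` (pedigree form).  §4 THE ROOM on the pass-V process `pedMV` (the shapes of
`HistoryBankingCreditPlug` with the fibre factor on the left): `evProd_pedMV_mul_le`, **`liveFactor_mul_fshare_le`**,
**`prod_liveFactor_mul_fshare_le`** = `LIVE · MULT ≤ PRICE` member by member and as a product over `histV.comp K`.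
§5 sanity: `RoundingRoomF` is inhabited (toy sharps = gen 45's toy sharps + the shares); `fshareP` on a decided toy.

HONEST SCOPE.  Bookkeeping; `RoundingRoomF`, `FactorRead` are HYPOTHESIS SHAPES (R-class readings of print's two
roundings (1.79) p. 383 ∕ p. 383 after (1.78) and of the factor values; VALUES of `φB`, `φR` are the supplier's, of
volume type); the display (ρ) `FibreMass`, the key-reading of `MULT` (node sums on the flat genealogy) and the END-side
plug (`resumM := (ρ)∕W`, `upM`, `priceM`) are the S12-W crew's (INTERFACE REQUEST IR-46-1).  BY-NAME EFFECT ON THE WALL: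
with this file + the crew's plug, `priceM` is KERNEL modulo the located displays {`HistRead`, `FactorRead`, `RoundingRoomF`,
volume calibrations} and `resumM` is the located volume-type display (ρ) + `W∞` (WALL-NE7b-P1 v1.20); `reprA∕reprB` ∕
`realised` unchanged.  NE7b NOT proved; spine 0∕9.  HONEST DEPENDENCY (cell): continuum YM on T⁴ ⇐ BetaPertH ∧ nine
spine estimates (0/9 proved); BetaPertH ⇐ (D1) ∧ (D4) ∧ CAP+tail; G-an2-4 gates asym, D1 and NE2/3/4.  This file
changes none of it.
-/

open Finset
open Literature.MathematicalPhysics.QuantumFieldTheory.Balaban1983to89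
open Literature.MathematicalPhysics.QuantumFieldTheory.Balaban1983to89.B13ScaleTransfer
open Literature.MathematicalPhysics.QuantumFieldTheory.Balaban1983to89.B16SProfile
open T4PersistenceDictionary T4PrintedShapeBanking T4TaggedShapeBanking T4BankedInduction T4PartnerMultiplicity
open T4BranchingRecordsGas
open Summit.QuantumFields.BalabanUV.T4Continuum.HistoryAdmissible
open Summit.QuantumFields.BalabanUV.T4Continuum.HistoryRealise
open Summit.QuantumFields.BalabanUV.T4Continuum.HistoryRealisePrint
open Summit.QuantumFields.BalabanUV.T4Continuum.HistoryRealiseWeak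
open Summit.QuantumFields.BalabanUV.T4Continuum.HistoryGen
open Summit.QuantumFields.BalabanUV.T4Continuum.HistoryGenealogyExtraction
open Summit.QuantumFields.BalabanUV.T4Continuum.HistoryGenealogyPedigree
open Summit.QuantumFields.BalabanUV.T4Continuum.HistoryGenealogyInstantiate
open Summit.QuantumFields.BalabanUV.T4Continuum.HistoryBankingLE
open Summit.QuantumFields.BalabanUV.T4Continuum.HistoryConstants
open Summit.QuantumFields.BalabanUV.T4Continuum.HistoryBankingVolumePlug
open Summit.QuantumFields.BalabanUV.T4Continuum.HistoryBankingDiscountCharge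
open Summit.QuantumFields.BalabanUV.T4Continuum.HistoryBankingCreditRead
open Summit.QuantumFields.BalabanUV.T4Continuum.HistoryBankingCreditPlug

namespace Summit.QuantumFields.BalabanUV.T4Continuum.HistoryBankingFibreRoom

noncomputable section

/-! ## §1 Inflated factor letters and the fibre share of a genealogy -/

section Inflate

variable {γ : Type*}

/-- **INFLATED BIRTH LETTERS**: `fB′ j d′ n := fB j d′ n · e^{φB j d′}` — the birth factor carrying the displayed fibre
share of a class-`d′` birth at step `j` (a bookkeeping device). [folklore] -/
def inflB (φB : ℕ → ℕ → ℝ) (fB : ℕ → ℕ → γ → ℝ) : ℕ → ℕ → γ → ℝ := fun j d n => fB j d n * Real.exp (φB j d)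

/-- **INFLATED RENEWAL LETTERS**: `fR′ h := fR h · e^{φR h}`. [folklore] -/
def inflR (φR : ℕ → ℝ) (fR : ℕ → ℝ) : ℕ → ℝ := fun h => fR h * Real.exp (φR h)

/-- inflated birth letter, unfolded [folklore] -/
@[simp] theorem inflB_apply (φB : ℕ → ℕ → ℝ) (fB : ℕ → ℕ → γ → ℝ) (j d : ℕ) (n : γ) :
    inflB φB fB j d n = fB j d n * Real.exp (φB j d) := rfl

/-- inflated renewal letter, unfolded [folklore] -/
@[simp] theorem inflR_apply (φR : ℕ → ℝ) (fR : ℕ → ℝ) (h : ℕ) : inflR φR fR h = fR h * Real.exp (φR h) := rfl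

/-- **THE FIBRE SHARE OF A GENEALOGY** (node sum over the `PGen`: a birth of class `d′` at step `j` contributes
`φB j d′`, a renewal by the level-`h` operation `φR h`, a join nothing — a merger's share, if wanted, is booked on the
absorbed root's `φB`, as `mshare` is); `MULT := exp ∘ fshareP` is the fibre factor of one live member. [folklore] -/
def fshareP (φB : ℕ → ℕ → ℝ) (φR : ℕ → ℝ) : PGen γ → ℝ
  | PGen.birth j d _ => φB j d
  | PGen.renew G h => φR h + fshareP φB φR G
  | PGen.join X Y _ => fshareP φB φR X + fshareP φB φR Y

variable (φB : ℕ → ℕ → ℝ) (φR : ℕ → ℝ)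

/-- fibre share of a birth [folklore] -/
@[simp] theorem fshareP_birth (j d : ℕ) (n : γ) : fshareP φB φR (PGen.birth j d n) = φB j d := rfl

/-- fibre share of a renewal [folklore] -/
@[simp] theorem fshareP_renew (G : PGen γ) (h : ℕ) : fshareP φB φR (PGen.renew G h) = φR h + fshareP φB φR G := rfl

/-- fibre share of a join [folklore] -/
@[simp] theorem fshareP_join (X Y : PGen γ) (s : ℕ) :
    fshareP φB φR (PGen.join X Y s) = fshareP φB φR X + fshareP φB φR Y := rfl

/-- nonnegative shares give a nonnegative fibre share [folklore] -/
theorem fshareP_nonneg (hB : ∀ j d, 0 ≤ φB j d) (hR : ∀ h, 0 ≤ φR h) : ∀ P : PGen γ, 0 ≤ fshareP φB φR P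
  | PGen.birth j d _ => hB j d
  | PGen.renew G h => add_nonneg (hR h) (fshareP_nonneg hB hR G)
  | PGen.join X Y _ => add_nonneg (fshareP_nonneg hB hR X) (fshareP_nonneg hB hR Y)

/-- the fibre factor is at least one for nonnegative shares [folklore] -/
theorem one_le_exp_fshareP (hB : ∀ j d, 0 ≤ φB j d) (hR : ∀ h, 0 ≤ φR h) (P : PGen γ) :
    1 ≤ Real.exp (fshareP φB φR P) :=
  Real.one_le_exp (fshareP_nonneg φB φR hB hR P)

/-- **THE EVENT PRODUCT OF THE INFLATED LETTERS IS THE EVENT PRODUCT TIMES THE FIBRE FACTOR**: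
`evProd fB′ fR′ P = evProd fB fR P · exp (fshareP φB φR P)`. [folklore] -/
theorem evProd_infl (fB : ℕ → ℕ → γ → ℝ) (fR : ℕ → ℝ) :
    ∀ P : PGen γ, evProd (inflB φB fB) (inflR φR fR) P = evProd fB fR P * Real.exp (fshareP φB φR P)
  | PGen.birth j d n => by simp
  | PGen.renew G h => by
      rw [evProd_renew, evProd_renew, evProd_infl fB fR G, fshareP_renew, Real.exp_add, inflR_apply]
      ring
  | PGen.join X Y s => by
      rw [evProd_join, evProd_join, evProd_infl fB fR X, evProd_infl fB fR Y, fshareP_join, Real.exp_add]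
      ring

variable {φB φR} {fB : ℕ → ℕ → γ → ℝ} {fR : ℕ → ℝ} {sB : ℕ → ℕ → ℝ} {sR : ℕ → ℝ}

/-- **THE INFLATED LETTERS ARE A FACTOR READING AT THE REDUCED SHARPS**: `0 ≤ fB′ ≤ e^{−(sB − φB)}`,
`0 ≤ fR′ ≤ e^{−(sR − φR)}`. [folklore] -/
theorem factorRead_infl (hF : FactorRead fB fR sB sR) :
    FactorRead (inflB φB fB) (inflR φR fR) (fun j d => sB j d - φB j d) (fun h => sR h - φR h) where
  fB_nonneg j d n := mul_nonneg (hF.fB_nonneg j d n) (Real.exp_pos _).le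
  fR_nonneg h := mul_nonneg (hF.fR_nonneg h) (Real.exp_pos _).le
  fB_le j d n := by
    rw [inflB_apply, neg_sub, sub_eq_neg_add, Real.exp_add]
    exact mul_le_mul_of_nonneg_right (hF.fB_le j d n) (Real.exp_pos _).le
  fR_le h := by
    rw [inflR_apply, neg_sub, sub_eq_neg_add, Real.exp_add]
    exact mul_le_mul_of_nonneg_right (hF.fR_le h) (Real.exp_pos _).le

end Inflate

/-! ## §2 The rounding-with-room junction WITH THE FIBRE SHARE BOOKED -/

section Room

/-- **THE ROUNDING-WITH-ROOM JUNCTION WITH THE FIBRE SHARE BOOKED** (HYPOTHESIS SHAPE, R-class reading; gen 45's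
`RoundingRoom` with one more displayed per-event share):
* `birth` — print's rounding of the fundamental large-field factor to the booked birth credit ((1.79) p. 383) READ WITH
  ROOM for the birth's discount share, one merger share at any later performed step, AND the birth's fibre share `φB j d′`;
* `renew` — print's rounding of the largest preparatory factor to «exp(−p₀(g_j))» (p. 383 after (1.78)) READ WITH ROOM for
  the renewal's discount share AND its fibre share `φR h` (event step `h + 1`).
The fibre shares are the supplier's letters of VOLUME TYPE (the reading of p. 383 «the summations over the admissible
sequences can be replaced by the factors exp O(1)(MR_j)^{−d}|Z_j|», booked per event); nothing of Bałaban's is asserted —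
the structure is inhabited by toy data (§5) and is the supplier's to discharge. [folklore] -/
structure RoundingRoomF (C : T4PrintedShapeBanking.Consts) (O : PrintedO1s) (L K : ℕ) (R : ℕ → ℕ) (g : ℕ → ℝ)
    (sB : ℕ → ℕ → ℝ) (sR : ℕ → ℝ) (φB : ℕ → ℕ → ℝ) (φR : ℕ → ℝ) : Prop where
  /-- births: booked credit + own share + one merger share at any later performed step + fibre share ≤ sharp exponent -/
  birth : ∀ e : PEv, e.kind = 0 → ∀ s, e.step ≤ s → s ≤ K →
    pcredit O C g e + dshare C L R e + mshare C L R s + φB e.step e.fat ≤ sB e.step e.fat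
  /-- renewals (event step `h + 1 ≥ 1`, performed): booked credit + own share + fibre share ≤ sharp exponent -/
  renew : ∀ e : PEv, e.kind = 1 → 1 ≤ e.step → e.step ≤ K →
    pcredit O C g e + dshare C L R e + φR (e.step - 1) ≤ sR (e.step - 1)

variable {C : T4PrintedShapeBanking.Consts} {O : PrintedO1s} {L K : ℕ} {R : ℕ → ℕ} {g : ℕ → ℝ} {sB : ℕ → ℕ → ℝ}
  {sR : ℕ → ℝ} {φB : ℕ → ℕ → ℝ} {φR : ℕ → ℝ}

/-- **THE BOOKED JUNCTION IS GEN 45's JUNCTION AT THE REDUCED SHARPS** `sB − φB`, `sR − φR`. [folklore] -/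
theorem RoundingRoomF.toRoundingRoom (h : RoundingRoomF C O L K R g sB sR φB φR) :
    RoundingRoom C O L K R g (fun j d => sB j d - φB j d) (fun h => sR h - φR h) where
  birth e he s hs hsK := by
    have := h.birth e he s hs hsK
    show _ ≤ sB e.step e.fat - φB e.step e.fat
    linarith
  renew e he h1 heK := by
    have := h.renew e he h1 heK
    show _ ≤ sR (e.step - 1) - φR (e.step - 1)
    linarith

/-- forgetting nonnegative fibre shares: the booked junction implies gen 45's junction at the same sharps [folklore] -/
theorem RoundingRoomF.roundingRoom (h : RoundingRoomF C O L K R g sB sR φB φR) (hB : ∀ j d, 0 ≤ φB j d)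
    (hR : ∀ h, 0 ≤ φR h) : RoundingRoom C O L K R g sB sR where
  birth e he s hs hsK := by
    have := h.birth e he s hs hsK
    have := hB e.step e.fat
    linarith
  renew e he h1 heK := by
    have := h.renew e he h1 heK
    have := hR (e.step - 1)
    linarith

/-- with ZERO fibre shares the booked junction IS gen 45's junction [folklore] -/
theorem roundingRoomF_zero_iff :
    RoundingRoomF C O L K R g sB sR (fun _ _ => 0) (fun _ => 0) ↔ RoundingRoom C O L K R g sB sR := by
  constructor
  · intro h
    exact h.roundingRoom (fun _ _ => le_rfl) fun _ => le_rfl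
  · intro h
    exact ⟨fun e he s hs hsK => by simpa using h.birth e he s hs hsK,
      fun e he h1 heK => by simpa using h.renew e he h1 heK⟩

end Room

/-! ## §3 The room on genealogies: event product × fibre factor against print's credits × the count's discount -/

section Genealogy

variable {γ : Type*} {ε : Type*} [DecidableEq ε] (sh : ε → PEv) {C : T4PrintedShapeBanking.Consts} {O : PrintedO1s}
  {L K : ℕ} {R : ℕ → ℕ} {g : ℕ → ℝ} {β' β₀ : ℝ} {fB : ℕ → ℕ → γ → ℝ} {fR : ℕ → ℝ} {sB : ℕ → ℕ → ℝ} {sR : ℕ → ℝ}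
  {φB : ℕ → ℕ → ℝ} {φR : ℕ → ℝ}

/-- **THE ROOM (M5-4a)**: under the event-wise factor readings `FactorRead`, the booked junction `RoundingRoomF`, (2.9) on
the run, `L ≥ 1`, `E₂ > 0`, `E₃ ≥ 0`, for a `ConsistentTLE`, well-formed tagged genealogy `G` whose shape-relabelling is
`P`'s canonical genealogy:
`evProd fB fR P · exp (fshareP φB φR P) ≤ exp (−credits (pcredit O C g ∘ sh) G) · exp (−(8∕E₂·totalCostT sh C K R G +
4·partnerAges (PEv.step ∘ sh) G))` — gen 45's credit reading at the inflated letters. [folklore] -/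
theorem evProd_mul_exp_fshareP_le (hF : FactorRead fB fR sB sR) (hRR : RoundingRoomF C O L K R g sB sR φB φR)
    (h29 : B14FlowStep.FlowIneq29 R g L β' β₀ K) (hL : 1 ≤ L) (hE₂ : 0 < C.E₂) (hE₃ : 0 ≤ C.E₃) {P : PGen γ}
    {G : Gen ε} (hsh : relabel sh G = P.toGen) (hW : G.WF (dictWT sh R C.n₁)) (hc : ConsistentTLE sh C K R G) :
    evProd fB fR P * Real.exp (fshareP φB φR P) ≤ Real.exp (-credits (pcredit O C g ∘ sh) G) *
      Real.exp (-(8 / C.E₂ * totalCostT sh C K R G + 4 * (partnerAges (PEv.step ∘ sh) G : ℝ))) := by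
  rw [← evProd_infl]
  exact evProd_le_exp_neg_credits_mul_exp_neg_discount sh (factorRead_infl hF) hRR.toRoundingRoom h29 hL hE₂ hE₃ hsh hW hc

variable {α π : Type*} [DecidableEq α] [DecidableEq π] [Inhabited γ]

/-- **… ON A `Pedigree` (shape `Prod.fst`)**: for a component `c` of a pedigree `Pd` with one-step-older renewed parts,
whose tagged genealogy `Pd.genT c` is well formed and `ConsistentTLE` at cutoff `K`:
`evProd fB fR (Pd.toPGen cell c) · exp (fshareP φB φR (Pd.toPGen cell c)) ≤ exp (−credits … (Pd.genT c)) · exp (−Ξ (Pd.genT c))`.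
[folklore] -/
theorem evProd_toPGen_mul_exp_fshareP_le_genT (hF : FactorRead fB fR sB sR)
    (hRR : RoundingRoomF C O L K R g sB sR φB φR) (h29 : B14FlowStep.FlowIneq29 R g L β' β₀ K) (hL : 1 ≤ L)
    (hE₂ : 0 < C.E₂) (hE₃ : 0 ≤ C.E₃) (Pd : Pedigree α π) (cell : π → γ)
    (hS : ∀ c c', Part.old c' true ∈ Pd.parts c → Pd.step c' + 1 = Pd.step c) (c : α)
    (hW : (Pd.genT c).WF (dictWT Prod.fst R C.n₁)) (hc : ConsistentTLE Prod.fst C K R (Pd.genT c)) :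
    evProd fB fR (Pd.toPGen cell c) * Real.exp (fshareP φB φR (Pd.toPGen cell c)) ≤
      Real.exp (-credits (pcredit O C g ∘ Prod.fst) (Pd.genT c)) *
        Real.exp (-(8 / C.E₂ * totalCostT Prod.fst C K R (Pd.genT c) +
          4 * (partnerAges (PEv.step ∘ Prod.fst) (Pd.genT c) : ℝ))) := by
  rw [← evProd_infl]
  exact evProd_toPGen_le_genT (factorRead_infl hF) hRR.toRoundingRoom h29 hL hE₂ hE₃ Pd cell hS c hW hc

end Genealogy

/-! ## §4 The room on the pass-V process: `LIVE · MULT ≤ PRICE` -/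

section PassV

-- the structural `DecidableEq` instance of the concrete tag type `Lab (ℕ × Lab d) (Lab d)` exceeds the default
-- synthesis size (as in `HistoryBankingCreditPlug`)
set_option synthInstance.maxSize 1024

variable {d : ℕ} {I : RunInputM d} {C : T4PrintedShapeBanking.Consts} {O : PrintedO1s} {L : ℕ} {g : ℕ → ℝ}
  {β' β₀ : ℝ} {fB : ℕ → ℕ → Pt d × Finset (Pt d) → ℝ} {fR : ℕ → ℝ} {sB : ℕ → ℕ → ℝ} {sR : ℕ → ℝ}
  {φB : ℕ → ℕ → ℝ} {φR : ℕ → ℝ}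

/-- **THE ROOM ON A LIVE DISSOLVED COMPONENT**: under `FactorRead`, `RoundingRoomF`, (2.9), `L ≥ 1`, `E₂ > 0`, `E₃ ≥ 0`
and the pass-V process conditions:
`evProd fB fR (pedMV.toPGen id (K, c)) · exp (fshareP φB φR (pedMV.toPGen id (K, c))) ≤ exp (−credits … (pedMV.genT (K, c))) ·
exp (−Ξ K (pedMV.genT (K, c)))`. [folklore] -/
theorem evProd_pedMV_mul_le (hN : I.NewOK) (hRm : ∀ t k, I.Rm t k ≤ I.R t) (hRmS : ∀ t k, I.Rm t (k + 1) ≤ I.R (t + 1))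
    (hRm2 : ∀ t, 2 ≤ I.Rm t 1) (hD : I.NewDisjoint) (hL : 0 < I.L) (hL4 : 4 ≤ I.L) (hdrop : ∀ m, DropCtl I.s m)
    (hR : ∀ t, 1 ≤ I.R t) (hn₁ : 13 ≤ C.n₁) (hE₂ : 0 < C.E₂) (hE₃ : 0 ≤ C.E₃) {K : ℕ} (hF : FactorRead fB fR sB sR)
    (hRR : RoundingRoomF C O L K I.R g sB sR φB φR) (h29 : B14FlowStep.FlowIneq29 I.R g L β' β₀ K) (hL1 : 1 ≤ L)
    {c : Pt d × Finset (Pt d)} (hc : c ∈ I.histV.comp K) :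
    evProd fB fR (I.pedMV.toPGen id (K, c)) * Real.exp (fshareP φB φR (I.pedMV.toPGen id (K, c))) ≤
      Real.exp (-credits (pcredit O C g ∘ Prod.fst) (I.pedMV.genT (K, c))) *
        Real.exp (-(8 / C.E₂ * totalCostT Prod.fst C K I.R (I.pedMV.genT (K, c)) +
          4 * (partnerAges (PEv.step ∘ Prod.fst) (I.pedMV.genT (K, c)) : ℝ))) := by
  rw [← evProd_infl]
  exact evProd_pedMV_le hN hRm hRmS hRm2 hD hL hL4 hdrop hR hn₁ hE₂ hE₃ (factorRead_infl hF) hRR.toRoundingRoom h29 hL1 hc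

/-- **THE LIVE FACTOR TIMES THE FIBRE FACTOR OF A LIVE DISSOLVED COMPONENT IS BELOW THE PRICE SENTENCE's PER-MEMBER
RIGHT-HAND SIDE** (the shape of `CountRoadWitnessT3bWTVS.priceM` per live member, `FcM := LIVE`, `RfM := MULT`): for any
weight `uV` of the class remainder and `G = pedMV.genT (K, c)`, `P = pedMV.toPGen id (K, c)`,
`(e^{lifeCost …  G} · e^{birthWT Prod.fst uV G} · evProd fB fR P) · exp (fshareP φB φR P)
  ≤ pshapeTH Prod.fst O C 1 1 I.R g 0 (costT Prod.fst C K I.R) G · e^{birthWT Prod.fst uV G} · e^{−Ξ K G}`. [folklore] -/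
theorem liveFactor_mul_fshare_le (hN : I.NewOK) (hRm : ∀ t k, I.Rm t k ≤ I.R t)
    (hRmS : ∀ t k, I.Rm t (k + 1) ≤ I.R (t + 1)) (hRm2 : ∀ t, 2 ≤ I.Rm t 1) (hD : I.NewDisjoint) (hL : 0 < I.L)
    (hL4 : 4 ≤ I.L) (hdrop : ∀ m, DropCtl I.s m) (hR : ∀ t, 1 ≤ I.R t) (hn₁ : 13 ≤ C.n₁) (hE₂ : 0 < C.E₂)
    (hE₃ : 0 ≤ C.E₃) {K : ℕ} (hF : FactorRead fB fR sB sR) (hRR : RoundingRoomF C O L K I.R g sB sR φB φR)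
    (h29 : B14FlowStep.FlowIneq29 I.R g L β' β₀ K) (hL1 : 1 ≤ L) (uV : ℕ → ℝ) {c : Pt d × Finset (Pt d)}
    (hc : c ∈ I.histV.comp K) :
    Real.exp (lifeCost (dictWT Prod.fst I.R C.n₁) (costT Prod.fst C K I.R) (I.pedMV.genT (K, c))) *
        Real.exp (birthWT Prod.fst uV (I.pedMV.genT (K, c))) * evProd fB fR (I.pedMV.toPGen id (K, c)) *
        Real.exp (fshareP φB φR (I.pedMV.toPGen id (K, c))) ≤
      pshapeTH Prod.fst O C 1 1 I.R g 0 (costT Prod.fst C K I.R) (I.pedMV.genT (K, c)) *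
        Real.exp (birthWT Prod.fst uV (I.pedMV.genT (K, c))) *
        Real.exp (-(8 / C.E₂ * totalCostT Prod.fst C K I.R (I.pedMV.genT (K, c)) +
          4 * (partnerAges (PEv.step ∘ Prod.fst) (I.pedMV.genT (K, c)) : ℝ))) := by
  have h := liveFactor_pedMV_le hN hRm hRmS hRm2 hD hL hL4 hdrop hR hn₁ hE₂ hE₃ (factorRead_infl hF) hRR.toRoundingRoom h29 hL1
    (O := O) uV hc
  rw [evProd_infl] at h
  calc _ = Real.exp (lifeCost (dictWT Prod.fst I.R C.n₁) (costT Prod.fst C K I.R) (I.pedMV.genT (K, c))) *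
        Real.exp (birthWT Prod.fst uV (I.pedMV.genT (K, c))) *
        (evProd fB fR (I.pedMV.toPGen id (K, c)) * Real.exp (fshareP φB φR (I.pedMV.toPGen id (K, c)))) := by ring
    _ ≤ _ := h

/-- the live factor times the fibre factor is nonnegative [folklore] -/
theorem liveFactor_mul_fshare_nonneg (hF : FactorRead fB fR sB sR) (R : ℕ → ℕ) (K : ℕ) (uV : ℕ → ℝ)
    (x : ℕ × (Pt d × Finset (Pt d))) :
    0 ≤ Real.exp (lifeCost (dictWT Prod.fst R C.n₁) (costT Prod.fst C K R) (I.pedMV.genT x)) *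
      Real.exp (birthWT Prod.fst uV (I.pedMV.genT x)) * evProd fB fR (I.pedMV.toPGen id x) *
      Real.exp (fshareP φB φR (I.pedMV.toPGen id x)) :=
  mul_nonneg (liveFactor_nonneg (I := I) hF R K uV x) (Real.exp_pos _).le

/-- **`LIVE · MULT ≤ PRICE` OVER THE LIVE DISSOLVED COMPONENTS AT THE CUTOFF** (the `priceM` inequality of R-OWNER-46-1 at
`FcM := LIVE`, `RfM := MULT = ∏ exp fshareP`, before the key-reading):
`(∏_{x ∈ histV.comp K} liveFactor x) · (∏_{x ∈ histV.comp K} exp (fshareP φB φR (pedMV.toPGen id (K, x))))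
  ≤ ∏_{x ∈ histV.comp K} pshapeTH … (pedMV.genT (K, x)) · e^{birthWT … uV …} · e^{−Ξ K …}`. [folklore] -/
theorem prod_liveFactor_mul_fshare_le (hN : I.NewOK) (hRm : ∀ t k, I.Rm t k ≤ I.R t)
    (hRmS : ∀ t k, I.Rm t (k + 1) ≤ I.R (t + 1)) (hRm2 : ∀ t, 2 ≤ I.Rm t 1) (hD : I.NewDisjoint) (hL : 0 < I.L)
    (hL4 : 4 ≤ I.L) (hdrop : ∀ m, DropCtl I.s m) (hR : ∀ t, 1 ≤ I.R t) (hn₁ : 13 ≤ C.n₁) (hE₂ : 0 < C.E₂)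
    (hE₃ : 0 ≤ C.E₃) {K : ℕ} (hF : FactorRead fB fR sB sR) (hRR : RoundingRoomF C O L K I.R g sB sR φB φR)
    (h29 : B14FlowStep.FlowIneq29 I.R g L β' β₀ K) (hL1 : 1 ≤ L) (uV : ℕ → ℝ) :
    (∏ x ∈ I.histV.comp K,
        Real.exp (lifeCost (dictWT Prod.fst I.R C.n₁) (costT Prod.fst C K I.R) (I.pedMV.genT (K, x))) *
          Real.exp (birthWT Prod.fst uV (I.pedMV.genT (K, x))) * evProd fB fR (I.pedMV.toPGen id (K, x))) *
      ∏ x ∈ I.histV.comp K, Real.exp (fshareP φB φR (I.pedMV.toPGen id (K, x))) ≤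
      ∏ x ∈ I.histV.comp K,
        pshapeTH Prod.fst O C 1 1 I.R g 0 (costT Prod.fst C K I.R) (I.pedMV.genT (K, x)) *
          Real.exp (birthWT Prod.fst uV (I.pedMV.genT (K, x))) *
          Real.exp (-(8 / C.E₂ * totalCostT Prod.fst C K I.R (I.pedMV.genT (K, x)) +
            4 * (partnerAges (PEv.step ∘ Prod.fst) (I.pedMV.genT (K, x)) : ℝ))) := by
  rw [← Finset.prod_mul_distrib]
  exact Finset.prod_le_prod (fun x _ => liveFactor_mul_fshare_nonneg hF I.R K uV (K, x)) fun _ hx =>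
    liveFactor_mul_fshare_le hN hRm hRmS hRm2 hD hL hL4 hdrop hR hn₁ hE₂ hE₃ hF hRR h29 hL1 uV hx

end PassV

/-! ## §5 Sanity: the booked junction is inhabited; the fibre share on a decided toy (TOY symbols, not print's values) -/

namespace Sanity

open HistoryBankingCreditRead.Sanity

/-- toy sharp birth exponents WITH the fibre share: gen 45's toy birth sharps plus `φB`. [folklore] -/
def sBF (C : T4PrintedShapeBanking.Consts) (L : ℕ) (R : ℕ → ℕ) (K : ℕ) (O : PrintedO1s) (g : ℕ → ℝ)
    (φB : ℕ → ℕ → ℝ) (j d : ℕ) : ℝ :=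
  sB₁ C L R K O g j d + φB j d

/-- toy sharp renewal exponents WITH the fibre share: gen 45's toy renewal sharps plus `φR`. [folklore] -/
def sRF (C : T4PrintedShapeBanking.Consts) (L : ℕ) (R : ℕ → ℕ) (O : PrintedO1s) (g : ℕ → ℝ) (φR : ℕ → ℝ)
    (h : ℕ) : ℝ :=
  sR₁ C L R O g h + φR h

/-- **`RoundingRoomF` IS INHABITED** by the toy exponents over ANY constants with `E₂, E₃ ≥ 0` and ANY shares. [folklore] -/
theorem roundingRoomF_toy (C : T4PrintedShapeBanking.Consts) (hE₂ : 0 ≤ C.E₂) (hE₃ : 0 ≤ C.E₃) (L K : ℕ)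
    (R : ℕ → ℕ) (O : PrintedO1s) (g : ℕ → ℝ) (φB : ℕ → ℕ → ℝ) (φR : ℕ → ℝ) :
    RoundingRoomF C O L K R g (sBF C L R K O g φB) (sRF C L R O g φR) φB φR where
  birth e he s hs hsK := by
    have h := (roundingRoom_toy C hE₂ hE₃ L K R O g).birth e he s hs hsK
    unfold sBF
    linarith
  renew e he h1 heK := by
    have h := (roundingRoom_toy C hE₂ hE₃ L K R O g).renew e he h1 heK
    unfold sRF
    linarith

/-- the fibre share of gen 45's toy pedigree `P₀ = join (renew (birth 0 0 7) 3) (renew (birth 0 0 8) 3) 5` with unit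
shares is `4` (two births, two renewals; the join carries none) — decided. [folklore] -/
example : fshareP (fun _ _ => (1 : ℝ)) (fun _ => 1) P₀ = 4 := by
  simp only [P₀, fshareP]
  norm_num

/-- with unit shares the inflated event product of `P₀` is the event product times `e^4`. [folklore] -/
example (fB : ℕ → ℕ → ℕ → ℝ) (fR : ℕ → ℝ) :
    evProd (inflB (fun _ _ => (1 : ℝ)) fB) (inflR (fun _ => 1) fR) P₀ = evProd fB fR P₀ * Real.exp 4 := by
  rw [evProd_infl]
  congr 2
  simp only [P₀, fshareP]
  norm_num

end Sanity

end

end Summit.QuantumFields.BalabanUV.T4Continuum.HistoryBankingFibreRoom
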